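import Mathlib.Analysis.Calculus.BumpFunction.FiniteDimension
import Literature.Analysis.Calculus.ClassGermThree

/-!
# Smooth germs on a product of tori, symmetric under the stabiliser, factor through the class data — `D`-fold

The `D = Fin m`-fold version of ★ `exists_contDiffOn_comp_class_of_stabilizer`: base point `b = (b_w)_{w : Fin m}`,
`b_w ∈ ℝ³`; a smooth germ `g : (Fin m → Fin 3 → ℝ) × P → E` invariant, at every place `w`, under the slot permutations
fixing `(e^{i b_w k})_k` factors, near `b`, through the place-wise class data
`S_b(x) = (w ↦ (Σ_k λ_{w,k}, Σ_{j<k} λ_{w,j}λ_{w,k}, Π_k λ_{w,k}))`, `λ_{w,k} = e^{i(b_w k + x_w k)}`.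

Route (induction on the place count `m`): peel off the place `0`; apply the induction hypothesis to the remaining places
with the place-`0` offsets as extra parameters; RE-SYMMETRISE the resulting `F₂` over the (finite) stabiliser of `b₀` and
cut it off by a smooth bump supported where `F₂` is smooth (★ Mathlib `ContDiffBump` on a finite-dimensional space);
apply the one-place model ★ to this symmetric smooth germ with the remaining class data as parameters.
This is the local form of Glaeser's theorem for the Weyl group `S₃^m` of `U(3)^m` [Glaeser1963Newton, Thm. II], [Schwarz1975, Thm. 1].
-/

noncomputable section

open Complex Set
open scoped ContDiff Topology

namespace Literature.Analysis.Calculus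

/-! ## §1 Helpers: smooth cut-off of a function smooth on an open set; continuity of the class data -/

/-- A function smooth on an open set `s`, multiplied by a smooth scalar function whose topological support lies in `s`, is smooth everywhere.
[cite: Dieudonne1960, Ch. XVI §4] -/
theorem contDiff_smul_of_tsupport_subset {A : Type*} [NormedAddCommGroup A] [NormedSpace ℝ A] {E : Type*} [NormedAddCommGroup E] [NormedSpace ℝ E]
    {s : Set A} (hs : IsOpen s) {χ : A → ℝ} (hχ : ContDiff ℝ ∞ χ) (hsupp : tsupport χ ⊆ s) {f : A → E} (hf : ContDiffOn ℝ ∞ f s) :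
    ContDiff ℝ ∞ fun a => χ a • f a := by
  rw [contDiff_iff_contDiffAt]
  intro a
  by_cases ha : a ∈ s
  · exact hχ.contDiffAt.smul (hf.contDiffAt (hs.mem_nhds ha))
  · have hna : a ∉ tsupport χ := fun h => ha (hsupp h)
    have h0 : (fun a => χ a • f a) =ᶠ[𝓝 a] fun _ => (0 : E) := by
      filter_upwards [notMem_tsupport_iff_eventuallyEq.1 hna] with a' ha'
      simp [ha']
    exact (contDiffAt_const (c := (0 : E))).congr_of_eventuallyEq h0

/-- The place-wise class data depend continuously on the offsets. [cite: Dieudonne1960, Ch. III §11] -/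
theorem continuous_classPi {m : ℕ} (b : Fin m → Fin 3 → ℝ) :
    Continuous fun x : Fin m → Fin 3 → ℝ => (fun w => ((Complex.exp ((((b w 0 + x w 0 : ℝ)) : ℂ) * I) + Complex.exp ((((b w 1 + x w 1 : ℝ)) : ℂ) * I) + Complex.exp ((((b w 2 + x w 2 : ℝ)) : ℂ) * I),
          Complex.exp ((((b w 0 + x w 0 : ℝ)) : ℂ) * I) * Complex.exp ((((b w 1 + x w 1 : ℝ)) : ℂ) * I) + Complex.exp ((((b w 0 + x w 0 : ℝ)) : ℂ) * I) * Complex.exp ((((b w 2 + x w 2 : ℝ)) : ℂ) * I) + Complex.exp ((((b w 1 + x w 1 : ℝ)) : ℂ) * I) * Complex.exp ((((b w 2 + x w 2 : ℝ)) : ℂ) * I),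
          Complex.exp ((((b w 0 + x w 0 : ℝ)) : ℂ) * I) * Complex.exp ((((b w 1 + x w 1 : ℝ)) : ℂ) * I) * Complex.exp ((((b w 2 + x w 2 : ℝ)) : ℂ) * I)) : ℂ × ℂ × ℂ)) := by
  refine continuous_pi fun w => ?_
  fun_prop

/-! ## §2 The `m`-place germ model -/

universe u

variable {E : Type u} [NormedAddCommGroup E] [NormedSpace ℝ E] [CompleteSpace E]

/-- **SMOOTH GERMS SYMMETRIC UNDER THE STABILISER FACTOR THROUGH THE PLACE-WISE CLASS DATA (`m` PLACES).**  For `b : Fin m → ℝ³` and a `C^∞` germ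
`g : (Fin m → Fin 3 → ℝ) × P → E` with `g (update x w (x w ∘ σ), z) = g (x, z)` for every place `w` and every slot permutation `σ` fixing `(e^{i b_w k})_k`,
there are an open `W`, `F` smooth on `W × P` and `δ > 0` with `S_b x ∈ W` and **`F (S_b x, z) = g (x, z)` for `‖x‖ < δ`**
(`S_b x = (w ↦ (Σ λ, Σ λλ, Π λ))`, `λ_{w,k} = e^{i(b_w k + x_w k)}`; induction on `m` over ★ `exists_contDiffOn_comp_class_of_stabilizer`
with stabiliser re-symmetrisation and a smooth cut-off). [cite: Glaeser1963Newton, Thm. II] [cite: Schwarz1975, Thm. 1] [cite: Dieudonne1960, Ch. XVI §4] -/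
theorem exists_contDiffOn_comp_classPi_of_stabilizer (m : ℕ) {P : Type u} [NormedAddCommGroup P] [NormedSpace ℝ P] [FiniteDimensional ℝ P]
    (b : Fin m → Fin 3 → ℝ) (g : (Fin m → Fin 3 → ℝ) × P → E) (hg : ContDiff ℝ ∞ g)
    (hstab : ∀ (w : Fin m) (σ : Equiv.Perm (Fin 3)), (∀ k, Complex.exp ((b w (σ k) : ℂ) * I) = Complex.exp ((b w k : ℂ) * I)) →
      ∀ (x : Fin m → Fin 3 → ℝ) (z : P), g (Function.update x w (x w ∘ (⇑σ)), z) = g (x, z)) :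
    ∃ W : Set (Fin m → ℂ × ℂ × ℂ), IsOpen W ∧ ∃ F : (Fin m → ℂ × ℂ × ℂ) × P → E, ContDiffOn ℝ ∞ F (W ×ˢ Set.univ) ∧
      ∃ δ > (0 : ℝ), ∀ x : Fin m → Fin 3 → ℝ, ‖x‖ < δ → ∀ z : P, (fun w => ((Complex.exp ((((b w 0 + x w 0 : ℝ)) : ℂ) * I) + Complex.exp ((((b w 1 + x w 1 : ℝ)) : ℂ) * I) + Complex.exp ((((b w 2 + x w 2 : ℝ)) : ℂ) * I),
          Complex.exp ((((b w 0 + x w 0 : ℝ)) : ℂ) * I) * Complex.exp ((((b w 1 + x w 1 : ℝ)) : ℂ) * I) + Complex.exp ((((b w 0 + x w 0 : ℝ)) : ℂ) * I) * Complex.exp ((((b w 2 + x w 2 : ℝ)) : ℂ) * I) + Complex.exp ((((b w 1 + x w 1 : ℝ)) : ℂ) * I) * Complex.exp ((((b w 2 + x w 2 : ℝ)) : ℂ) * I),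
          Complex.exp ((((b w 0 + x w 0 : ℝ)) : ℂ) * I) * Complex.exp ((((b w 1 + x w 1 : ℝ)) : ℂ) * I) * Complex.exp ((((b w 2 + x w 2 : ℝ)) : ℂ) * I)) : ℂ × ℂ × ℂ)) ∈ W ∧ F ((fun w => ((Complex.exp ((((b w 0 + x w 0 : ℝ)) : ℂ) * I) + Complex.exp ((((b w 1 + x w 1 : ℝ)) : ℂ) * I) + Complex.exp ((((b w 2 + x w 2 : ℝ)) : ℂ) * I),
          Complex.exp ((((b w 0 + x w 0 : ℝ)) : ℂ) * I) * Complex.exp ((((b w 1 + x w 1 : ℝ)) : ℂ) * I) + Complex.exp ((((b w 0 + x w 0 : ℝ)) : ℂ) * I) * Complex.exp ((((b w 2 + x w 2 : ℝ)) : ℂ) * I) + Complex.exp ((((b w 1 + x w 1 : ℝ)) : ℂ) * I) * Complex.exp ((((b w 2 + x w 2 : ℝ)) : ℂ) * I),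
          Complex.exp ((((b w 0 + x w 0 : ℝ)) : ℂ) * I) * Complex.exp ((((b w 1 + x w 1 : ℝ)) : ℂ) * I) * Complex.exp ((((b w 2 + x w 2 : ℝ)) : ℂ) * I)) : ℂ × ℂ × ℂ)), z) = g (x, z) := by
  induction m generalizing P with
  | zero =>
    refine ⟨Set.univ, isOpen_univ, fun q => g (fun w => w.elim0, q.2), (hg.comp (contDiff_const.prodMk contDiff_snd)).contDiffOn, 1, one_pos,
      fun x _ z => ⟨Set.mem_univ _, ?_⟩⟩
    show g (fun w => w.elim0, z) = g (x, z)
    rw [Subsingleton.elim (fun w : Fin 0 => (w.elim0 : Fin 3 → ℝ)) x]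
  | succ m ih =>
    classical
    -- the class data, as functions
    set SM : (Fin (m + 1) → Fin 3 → ℝ) → (Fin (m + 1) → ℂ × ℂ × ℂ) := fun x => (fun w => ((Complex.exp ((((b w 0 + x w 0 : ℝ)) : ℂ) * I) + Complex.exp ((((b w 1 + x w 1 : ℝ)) : ℂ) * I) + Complex.exp ((((b w 2 + x w 2 : ℝ)) : ℂ) * I),
          Complex.exp ((((b w 0 + x w 0 : ℝ)) : ℂ) * I) * Complex.exp ((((b w 1 + x w 1 : ℝ)) : ℂ) * I) + Complex.exp ((((b w 0 + x w 0 : ℝ)) : ℂ) * I) * Complex.exp ((((b w 2 + x w 2 : ℝ)) : ℂ) * I) + Complex.exp ((((b w 1 + x w 1 : ℝ)) : ℂ) * I) * Complex.exp ((((b w 2 + x w 2 : ℝ)) : ℂ) * I),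
          Complex.exp ((((b w 0 + x w 0 : ℝ)) : ℂ) * I) * Complex.exp ((((b w 1 + x w 1 : ℝ)) : ℂ) * I) * Complex.exp ((((b w 2 + x w 2 : ℝ)) : ℂ) * I)) : ℂ × ℂ × ℂ)) with hSM
    set ST : (Fin m → Fin 3 → ℝ) → (Fin m → ℂ × ℂ × ℂ) := fun x' => (fun w => ((Complex.exp (((((Fin.tail b) w 0 + x' w 0 : ℝ)) : ℂ) * I) + Complex.exp (((((Fin.tail b) w 1 + x' w 1 : ℝ)) : ℂ) * I) + Complex.exp (((((Fin.tail b) w 2 + x' w 2 : ℝ)) : ℂ) * I),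
          Complex.exp (((((Fin.tail b) w 0 + x' w 0 : ℝ)) : ℂ) * I) * Complex.exp (((((Fin.tail b) w 1 + x' w 1 : ℝ)) : ℂ) * I) + Complex.exp (((((Fin.tail b) w 0 + x' w 0 : ℝ)) : ℂ) * I) * Complex.exp (((((Fin.tail b) w 2 + x' w 2 : ℝ)) : ℂ) * I) + Complex.exp (((((Fin.tail b) w 1 + x' w 1 : ℝ)) : ℂ) * I) * Complex.exp (((((Fin.tail b) w 2 + x' w 2 : ℝ)) : ℂ) * I),
          Complex.exp (((((Fin.tail b) w 0 + x' w 0 : ℝ)) : ℂ) * I) * Complex.exp (((((Fin.tail b) w 1 + x' w 1 : ℝ)) : ℂ) * I) * Complex.exp (((((Fin.tail b) w 2 + x' w 2 : ℝ)) : ℂ) * I)) : ℂ × ℂ × ℂ)) with hST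
    set S0 : (Fin 3 → ℝ) → ℂ × ℂ × ℂ := fun y => ((Complex.exp ((((b 0 0 + y 0 : ℝ)) : ℂ) * I) + Complex.exp ((((b 0 1 + y 1 : ℝ)) : ℂ) * I) + Complex.exp ((((b 0 2 + y 2 : ℝ)) : ℂ) * I),
          Complex.exp ((((b 0 0 + y 0 : ℝ)) : ℂ) * I) * Complex.exp ((((b 0 1 + y 1 : ℝ)) : ℂ) * I) + Complex.exp ((((b 0 0 + y 0 : ℝ)) : ℂ) * I) * Complex.exp ((((b 0 2 + y 2 : ℝ)) : ℂ) * I) + Complex.exp ((((b 0 1 + y 1 : ℝ)) : ℂ) * I) * Complex.exp ((((b 0 2 + y 2 : ℝ)) : ℂ) * I),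
          Complex.exp ((((b 0 0 + y 0 : ℝ)) : ℂ) * I) * Complex.exp ((((b 0 1 + y 1 : ℝ)) : ℂ) * I) * Complex.exp ((((b 0 2 + y 2 : ℝ)) : ℂ) * I)) : ℂ × ℂ × ℂ) with hS0
    show ∃ W : Set (Fin (m + 1) → ℂ × ℂ × ℂ), IsOpen W ∧ ∃ F : (Fin (m + 1) → ℂ × ℂ × ℂ) × P → E, ContDiffOn ℝ ∞ F (W ×ˢ Set.univ) ∧
      ∃ δ > (0 : ℝ), ∀ x : Fin (m + 1) → Fin 3 → ℝ, ‖x‖ < δ → ∀ z : P, SM x ∈ W ∧ F (SM x, z) = g (x, z)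
    rcases isEmpty_or_nonempty P with hP | hP
    · exact ⟨Set.univ, isOpen_univ, fun q => g (0, q.2), (hg.comp (contDiff_const.prodMk contDiff_snd)).contDiffOn, 1, one_pos,
        fun x _ z => isEmptyElim z⟩
    obtain ⟨z₀⟩ := hP
    have hSM0 : ∀ x, SM x 0 = S0 (x 0) := fun x => rfl
    have hSMt : ∀ x, Fin.tail (SM x) = ST (Fin.tail x) := fun x => rfl
    -- (1) induction hypothesis on the places `1, …, m`, the place-`0` offsets as parameters
    set g₂ : (Fin m → Fin 3 → ℝ) × ((Fin 3 → ℝ) × P) → E := fun q => g (Fin.cons q.2.1 q.1, q.2.2) with hg₂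
    have hcons : ContDiff ℝ ∞ fun q : (Fin m → Fin 3 → ℝ) × ((Fin 3 → ℝ) × P) => (Fin.cons q.2.1 q.1 : Fin (m + 1) → Fin 3 → ℝ) := by
      refine contDiff_pi.2 fun w => ?_
      refine Fin.cases ?_ (fun i => ?_) w
      · simp only [Fin.cons_zero]; exact contDiff_fst.comp contDiff_snd
      · simp only [Fin.cons_succ]; exact (contDiff_apply ℝ (Fin 3 → ℝ) i).comp contDiff_fst
    have hg₂s : ContDiff ℝ ∞ g₂ := hg.comp (hcons.prodMk (contDiff_snd.comp contDiff_snd))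
    have hstab₂ : ∀ (w : Fin m) (σ : Equiv.Perm (Fin 3)), (∀ k, Complex.exp ((Fin.tail b w (σ k) : ℂ) * I) = Complex.exp ((Fin.tail b w k : ℂ) * I)) →
        ∀ (x : Fin m → Fin 3 → ℝ) (p : (Fin 3 → ℝ) × P), g₂ (Function.update x w (x w ∘ (⇑σ)), p) = g₂ (x, p) := by
      intro w σ hσ x p
      have h := hstab w.succ σ hσ (Fin.cons p.1 x) p.2
      rw [Fin.cons_succ] at h
      simp only [hg₂]
      rw [Fin.cons_update]
      exact h
    obtain ⟨W₂, hW₂o, F₂, hF₂, δ₂, hδ₂, h₂⟩ := ih (Fin.tail b) g₂ hg₂s hstab₂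
    -- the centre `c = ST 0` and a bump around it inside `W₂`
    have hc : ST 0 ∈ W₂ := (h₂ 0 (by simpa using hδ₂) (0, z₀)).1
    obtain ⟨r, hr, hball⟩ := Metric.isOpen_iff.1 hW₂o (ST 0) hc
    let χ : ContDiffBump (ST 0) := ⟨r / 4, r / 2, by positivity, by linarith⟩
    have hχ1 : ∀ sc ∈ Metric.ball (ST 0) (r / 4), (χ : (Fin m → ℂ × ℂ × ℂ) → ℝ) sc = 1 :=
      fun sc h => χ.one_of_mem_closedBall (Metric.ball_subset_closedBall h)
    have hχsupp : tsupport (χ : (Fin m → ℂ × ℂ × ℂ) → ℝ) ⊆ W₂ := by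
      rw [χ.tsupport_eq]
      exact (Metric.closedBall_subset_ball (by show r / 2 < r; linarith)).trans hball
    -- (2) the stabiliser of `b 0`
    set Λ : Fin 3 → ℂ := fun k => Complex.exp ((b 0 k : ℂ) * I) with hΛ
    set Γ : Finset (Equiv.Perm (Fin 3)) := Finset.univ.filter fun σ => ∀ k, Λ (σ k) = Λ k with hΓ
    have hmemΓ : ∀ σ, σ ∈ Γ ↔ ∀ k, Λ (σ k) = Λ k := fun σ => by simp [hΓ]
    have h1Γ : (1 : Equiv.Perm (Fin 3)) ∈ Γ := (hmemΓ 1).2 fun k => rfl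
    have hΓpos : (0 : ℝ) < Γ.card := Nat.cast_pos.2 (Finset.card_pos.2 ⟨1, h1Γ⟩)
    have hΓmul : ∀ τ ∈ Γ, ∀ σ ∈ Γ, τ * σ ∈ Γ := by
      intro τ hτ σ hσ
      rw [hmemΓ] at hτ hσ ⊢
      intro k
      rw [Equiv.Perm.mul_apply, hτ, hσ]
    have hΓinv : ∀ τ ∈ Γ, τ⁻¹ ∈ Γ := by
      intro τ hτ
      rw [hmemΓ] at hτ ⊢
      intro k
      show Λ (τ.symm k) = Λ k
      have h := hτ (τ.symm k)
      rw [Equiv.apply_symm_apply] at h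
      exact h.symm
    -- (3) the symmetrised, cut-off germ at the place `0`, parameters `(sc, z)`
    set g₁ : (Fin 3 → ℝ) × ((Fin m → ℂ × ℂ × ℂ) × P) → E :=
      fun q => (χ : (Fin m → ℂ × ℂ × ℂ) → ℝ) q.2.1 • (((Γ.card : ℝ))⁻¹ • ∑ σ ∈ Γ, F₂ (q.2.1, (q.1 ∘ (⇑σ), q.2.2))) with hg₁
    have hπc : Continuous fun q : (Fin 3 → ℝ) × ((Fin m → ℂ × ℂ × ℂ) × P) => q.2.1 := continuous_fst.comp continuous_snd
    have hg₁s : ContDiff ℝ ∞ g₁ := by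
      refine contDiff_smul_of_tsupport_subset (s := (fun q : (Fin 3 → ℝ) × ((Fin m → ℂ × ℂ × ℂ) × P) => q.2.1) ⁻¹' W₂) (hW₂o.preimage hπc)
        (χ.contDiff.comp (contDiff_fst.comp contDiff_snd)) ?_ ?_
      · refine (closure_minimal (fun q hq => ?_) ((isClosed_tsupport _).preimage hπc)).trans fun q hq => hχsupp hq
        exact subset_closure hq
      · refine ContDiffOn.const_smul _ (ContDiffOn.sum fun σ _ => ?_)
        refine hF₂.comp ((contDiff_fst.comp contDiff_snd).prodMk
          ((contDiff_pi.2 fun k => (contDiff_apply ℝ ℝ (σ k)).comp contDiff_fst).prodMk (contDiff_snd.comp contDiff_snd))).contDiffOn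
          fun q hq => ?_
        exact Set.mk_mem_prod hq (Set.mem_univ _)
    have hstab₁ : ∀ τ : Equiv.Perm (Fin 3), (∀ k, Complex.exp ((b 0 (τ k) : ℂ) * I) = Complex.exp ((b 0 k : ℂ) * I)) →
        ∀ (y : Fin 3 → ℝ) (p : (Fin m → ℂ × ℂ × ℂ) × P), g₁ (y ∘ (⇑τ), p) = g₁ (y, p) := by
      intro τ hτ y p
      have hτΓ : τ ∈ Γ := (hmemΓ τ).2 hτ
      simp only [hg₁]
      congr 2
      refine Finset.sum_equiv (Equiv.mulLeft τ) (fun σ => ⟨fun h => hΓmul τ hτΓ σ h, fun h => ?_⟩) (fun σ _ => ?_)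
      · have h' := hΓmul τ⁻¹ (hΓinv τ hτΓ) _ h
        simpa using h'
      · simp [Equiv.Perm.coe_mul, Function.comp_assoc]
    -- (4) the one-place model at `b 0`
    obtain ⟨W₁, hW₁o, F₁, hF₁, δ₁, hδ₁, h₁⟩ := exists_contDiffOn_comp_class_of_stabilizer (b 0) g₁ hg₁s hstab₁
    -- (5) `W`, `F`, `δ`
    have htailc : Continuous fun x : Fin (m + 1) → Fin 3 → ℝ => Fin.tail x := continuous_pi fun i => continuous_apply i.succ
    have htailC : Continuous fun sf : Fin (m + 1) → ℂ × ℂ × ℂ => Fin.tail sf := continuous_pi fun i => continuous_apply i.succ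
    have hSTc : ContinuousAt (fun x : Fin (m + 1) → Fin 3 → ℝ => ST (Fin.tail x)) 0 := by
      have hc' : Continuous ST := by rw [hST]; exact continuous_classPi (Fin.tail b)
      exact (hc'.comp htailc).continuousAt
    have ht0 : Fin.tail (0 : Fin (m + 1) → Fin 3 → ℝ) = 0 := rfl
    have N3 : (fun x : Fin (m + 1) → Fin 3 → ℝ => ST (Fin.tail x)) ⁻¹' Metric.ball (ST 0) (r / 4) ∈ 𝓝 (0 : Fin (m + 1) → Fin 3 → ℝ) := by
      refine hSTc.preimage_mem_nhds (Metric.isOpen_ball.mem_nhds ?_)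
      have hr4 : (0 : ℝ) < r / 4 := by positivity
      simpa only [ht0] using Metric.mem_ball_self (x := ST 0) hr4
    obtain ⟨δ₃, hδ₃, hball₃⟩ := Metric.mem_nhds_iff.1 N3
    refine ⟨{sf | sf 0 ∈ W₁ ∧ Fin.tail sf ∈ Metric.ball (ST 0) (r / 4)},
      (hW₁o.preimage (continuous_apply 0)).inter (Metric.isOpen_ball.preimage htailC),
      fun q => F₁ (q.1 0, (Fin.tail q.1, q.2)), ?_, min δ₁ (min δ₂ δ₃), lt_min hδ₁ (lt_min hδ₂ hδ₃), fun x hx z => ?_⟩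
    · -- smoothness on `W × P`
      have htails : ContDiff ℝ ∞ fun q : (Fin (m + 1) → ℂ × ℂ × ℂ) × P => Fin.tail q.1 :=
        contDiff_pi.2 fun i => (contDiff_apply ℝ (ℂ × ℂ × ℂ) i.succ).comp contDiff_fst
      refine hF₁.comp (((contDiff_apply ℝ (ℂ × ℂ × ℂ) 0).comp contDiff_fst).prodMk (htails.prodMk contDiff_snd)).contDiffOn fun q hq => ?_
      exact Set.mk_mem_prod (Set.mem_prod.1 hq).1.1 (Set.mem_univ _)
    · have hx₁ : ‖x 0‖ < δ₁ := lt_of_le_of_lt (norm_le_pi_norm x 0) (lt_of_lt_of_le hx (min_le_left _ _))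
      have hx₂ : ‖Fin.tail x‖ < δ₂ :=
        lt_of_le_of_lt ((pi_norm_le_iff_of_nonneg (norm_nonneg x)).2 fun i => norm_le_pi_norm x i.succ)
          (lt_of_lt_of_le hx ((min_le_right _ _).trans (min_le_left _ _)))
      have hx₃ : ST (Fin.tail x) ∈ Metric.ball (ST 0) (r / 4) :=
        hball₃ (by rw [Metric.mem_ball, dist_zero_right]; exact lt_of_lt_of_le hx ((min_le_right _ _).trans (min_le_right _ _)))
      obtain ⟨hm₁, he₁⟩ := h₁ (x 0) hx₁ (ST (Fin.tail x), z)
      have he₂ : ∀ σ ∈ Γ, F₂ (ST (Fin.tail x), (x 0 ∘ (⇑σ), z)) = g (x, z) := by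
        intro σ hσ
        have h := (h₂ (Fin.tail x) hx₂ (x 0 ∘ (⇑σ), z)).2
        rw [h]
        simp only [hg₂]
        rw [← Fin.update_cons_zero (x 0), Fin.cons_self_tail]
        exact hstab 0 σ ((hmemΓ σ).1 hσ) x z
      refine ⟨⟨?_, ?_⟩, ?_⟩
      · show SM x 0 ∈ W₁
        rw [hSM0]; exact hm₁
      · show Fin.tail (SM x) ∈ Metric.ball (ST 0) (r / 4)
        rw [hSMt]; exact hx₃
      · show F₁ (SM x 0, (Fin.tail (SM x), z)) = g (x, z)
        rw [hSM0, hSMt, he₁]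
        simp only [hg₁]
        rw [hχ1 _ hx₃, one_smul, Finset.sum_congr rfl he₂, Finset.sum_const, ← Nat.cast_smul_eq_nsmul ℝ, inv_smul_smul₀ (ne_of_gt hΓpos)]

end Literature.Analysis.Calculus

end
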